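import Summits.BirchSwinnertonDyer.BirchSwinnertonDyer.Theorems.EisensteinPrimesBSDpOnCellCReorientedDatum
import Summits.BirchSwinnertonDyer.Rank1Residual.X2.NonsplitCellCClassInt
import Summits.BirchSwinnertonDyer.Rank1Residual.X2.SplitCellCClassInt
import Summits.BirchSwinnertonDyer.BirchSwinnertonDyer.Theorems.EisensteinPrimesBSDpOnCellCCtlSplitClass
import HarnessLib

/-!
# Crux 4 `BSDpOnCellC` (stmt-BirchSwinnertonDyer-19034), line b1: the b1 roads RE-THREADED on the
# RE-ORIENTED IMC atoms c3♭′ / c3s♭′ (`X2.NonsplitIMCEqOnTreeIntOther`, `X2.SplitIMCEqOnTreeIntOther`;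
# X-slot at `𝔭̄`, frames at `(ι′, 𝔭)` — RULING L31 (R1)) — PART 2: POINTWISE WITH A MANIN DATUM PRIME
# TO `p` (the Heegner field PRODUCED), BOTH signs (cell `bsd-eis`, seat `bsd-eis-cgshw` g12; part 1 =
# `…ReorientedDatum.lean`)

HONEST FRAMING (cell `bsd-eis`, run/shared/lean/pub/bsd-eis/): theorems only; nothing booked; X2 stays
CONSTRUCTION-SHAPED; no label or count moves; BSD is not proved by any of this. Every theorem is
CONDITIONAL on its displayed binders — in particular on the value atom c2♭ / c2s♭ (NOT in print at
`3 ‖ N`) and the re-oriented IMC atom c3♭′ / c3s♭′ (Keller–Yin Thm. D shape, PREPRINT with the L1754 gap).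

## What is re-threaded, and the one new step

The tree's b1 roads `X2.bsdp_of_cellC_of_not_split_of_hsieh2014_of_intHalvesOnTree_of_partner` (k5-c4,
`X2/NonsplitHalvesOnTreeInt.lean`), `X2.bsdp_of_cellC_of_split_of_hsieh2014_of_intHalvesOnTree_of_partner`
(cgshw g8, `X2/SplitHalvesOnTreeInt.lean`) and their pointwise-with-Manin-datum consumers
`X2.bsdp_of_cellC_of_not_split_of_manin_of_intResiduals(_of_partner)` /
`X2.bsdp_of_cellC_of_split_of_manin_of_intResiduals` instantiate the IMC atom at the frame's own prime
`𝔭`. Here the SAME proofs run with the IMC atom read at the OTHER prime `𝔭̄` (produced by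
`X11b.LocalIndexTransport.exists_conj_prime_of_splitsIn`, degree one by `X11b.degreeOne_of_splitsIn`): the
two ♭ atoms at Hsieh's frame `Q` at `(ι′, 𝔭)` give (IMC∘BDP)@`𝟙` at `(𝔭̄, embAt K p 𝔭̄)` by
`Theorems.LogSymmetry.imcWaldspurgerOnTreeAt_other_of_intHalves_of_not_split_of_rankOne` /
`…_of_splitControl` (control theorem at `𝔭̄`; `ord_p log_𝔭 P = ord_p log_𝔭̄ P` in rank one), and the
UNCHANGED shadow-link consumers (`X2.bsdp_of_cellC_of_not_split_of_imcWaldspurgerOnTree_of_partner`,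
`X11b.exists_shadowLinks_of_onTree_of_heegner` + `X2.bsdp_of_cellC_of_indexIdentityAt`) conclude at `𝔭̄`.
The only new binder is `Odd (discr K)` (Keller–Yin §0.1), which the Manin-level theorems already HAVE
(`exists_admissibleField_of_rootNumber_eq_neg_one`: `d_K ≡ 1 (mod 8)` by Hoffstein–Luo).

* §1 datum level: `bsdp_of_cellC_of_not_split_of_hsieh2014_of_intHalvesOther_of_partner`,
  `bsdp_of_cellC_of_split_of_hsieh2014_of_intHalvesOther_of_partner`.
* §2 pointwise with a Manin datum prime to `p` (the field PRODUCED): non-split `…_of_partner` form and the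
  parity-cases form (`hMCB` = Mazur's MC on X2b ∩ {non-split}); split parity-cases form with CTL-split
  the THEOREM `Theorems.CtlLoc.splitControlOnTree_of_cellC` (k5-c4 g5, p484252) — no «CTL ∨ switch».

References: [Castella2018] Thm. 2.3, Thm. 3.2, §5 (arXiv:1704.06608 pp. 5, 9, 12); [CastellaEtAl2021]
Thm. 5.3.1 and (5.5)–(5.7); [Hsieh2014] Thm. 1; [KellerYin2024] Thm. D (PRE); [GrossZagier1986] I.(6.3);
[Mazur1978] Cor. 4.1; [Miller2011LMS] Def. 1.1; RULINGS L29 / L31; cell memos c3h MEMO-2, cgshw MEMO-14.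
-/

set_option autoImplicit false
set_option linter.dupNamespace false

noncomputable section

open scoped Classical MatrixGroups ModularForm

open CongruenceSubgroup WeierstrassCurve NumberField IsDedekindDomain Field PowerSeries
  Literature.NumberTheory.EllipticCurves Literature.NumberTheory.EllipticCurves.GreenbergSelmer
  Literature.NumberTheory.EllipticCurves.ModularForms Literature.NumberTheory.QuadraticFields
  Literature.NumberTheory.EllipticCurves.Rank1Residual
  Literature.NumberTheory.EllipticCurves.Rank1Residual.Typed
  Literature.NumberTheory.EllipticCurves.KrizLi2019
  Literature.NumberTheory.EllipticCurves.GreenbergVatsal2000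
  Literature.NumberTheory.EllipticCurves.Wuthrich2014
  Literature.NumberTheory.EllipticCurves.SteinWuthrich2013
  Literature.NumberTheory.GaloisRepresentations Literature.NumberTheory.GaloisCohomology
  Literature.NumberTheory.Automorphic
  Summit.BirchSwinnertonDyer.Rank1Residual.X11b.AcSelmer
  Summit.BirchSwinnertonDyer.Rank1Residual.X11b.Halves
  Summit.BirchSwinnertonDyer.Rank1Residual.X11b
  Summit.BirchSwinnertonDyer.Rank1Residual.X2
  Summit.BirchSwinnertonDyer.Rank1Residual

namespace Summit.BirchSwinnertonDyer.BirchSwinnertonDyer.Theorems.Reoriented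

/-! ### §2 Pointwise with a Manin datum prime to `p`: the Heegner field PRODUCED (odd `d_K`) -/

section Pointwise

variable (W : WeierstrassCurve ℚ) [W.IsElliptic] [W.IsGloballyMinimal] (p : ℕ) [Fact p.Prime]

/-- **X2c ∩ {non-split}, pointwise with a Manin datum, partner-supply form, IMC atom RE-ORIENTED** —
`X2.bsdp_of_cellC_of_not_split_of_manin_of_intResiduals_of_partner` with `h3 : X2.NonsplitIMCEqOnTreeIntOther W p`.
The datum is produced verbatim as there (Hoffstein–Luo field with ODD `d_K < −4` — the oddness now
USED —, Heegner datum, Gross–Zagier, Néron twist, `htamK`, `(κ, γ)`, degree-one `𝔭`), then §1.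
CONDITIONAL on every listed binder; nothing booked. [cite: CastellaEtAl2021, Thm. 5.3.1 and (5.5)–(5.7)]
[cite: Hsieh2014, Thm. 1 (arXiv:1112.1580 pp. 3–4)] [claim: KellerYin2024, status: under-review]
[cite: GrossZagier1986, I.(6.3)] [cite: Miller2011LMS, Def. 1.1] -/
theorem bsdp_of_cellC_of_not_split_of_manin_of_intResidualsOther_of_partner
    (hnf : exists_isNewformOf)
    (hPT : ∀ (K : Type) [Field K] [NumberField K], poitouTate_selmerStructure_duality K)
    (hPT2 : ∀ (K : Type) [Field K] [NumberField K], poitouTate_sha_tateDual K)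
    (hEP : ∀ (K : Type) [Field K] [NumberField K] (v : HeightOneSpectrum (𝓞 K)),
      localEulerPoincareCharacteristic (v.adicCompletion K))
    (hcd : fieldCdLE_two_of_numberField)
    (hBr : ∀ (K : Type) [Field K] [NumberField K] (p : ℕ) [Fact p.Prime],
      ZpExtension.decomp_not_le_kerSubgroup_of_isAnticyclotomic K p)
    (hH : hsieh2014_exists_anticyclotomicPAdicLFunction)
    (hGZ : ∀ (N : ℕ) [NeZero N] (W : WeierstrassCurve ℚ) (K : Type) [Field K] [NumberField K],
      gross_zagier N W K)
    (hKo : ∀ (N : ℕ) [NeZero N] (W : WeierstrassCurve ℚ) (K : Type) [Field K] [NumberField K],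
      kolyvagin N W K)
    (hHP : ∀ (N : ℕ) [NeZero N] (W : WeierstrassCurve ℚ) (K : Type) [Field K] [NumberField K],
      heegnerPointComplex_mem_range_map N W K)
    (hGZK : rank_eq_analyticRank_of_analyticRank_le_one)
    (hHL : HoffsteinLuo1997_exists_twist_L_one_ne_zero)
    (hc : CellC W p) (hns : ¬ W.HasSplitMultiplicativeReductionAtPrime p)
    (hMan : HasPrimeToManinDatum W p)
    (h2 : NonsplitBDPValueOnTreeInt W p) (h3 : NonsplitIMCEqOnTreeIntOther W p)
    (hpartner : ∀ (K : Type) [Field K] [NumberField K], IsImaginaryQuadratic K →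
        Odd (NumberField.discr K) → NumberField.discr K < -4 →
        SatisfiesHeegnerHypothesis (W.conductorNorm ℤ) K → SatisfiesHeegnerHypothesis p K →
        (W.quadraticTwist (NumberField.discr K : ℚ)).entireLFunction 1 ≠ 0 →
      ∀ (Wd : WeierstrassCurve ℚ) [Wd.IsElliptic] [Wd.IsGloballyMinimal],
        (∃ C : VariableChange ℚ, C • Wd = W.quadraticTwist (NumberField.discr K : ℚ)) →
        Wd.analyticRank = 0 → PPartRankZero Wd p) :
    BSDp W p := by
  have hp : p.Prime := Fact.out
  have hmod : hasEntireLFunction_rat := WeierstrassCurve.hasEntireLFunction_rat_of_exists_isNewformOf hnf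
  obtain ⟨hr, hp2, hred, hmult⟩ := hc
  haveI : NeZero (W.conductorNorm ℤ) := ⟨(W.conductorNorm_pos_holds).ne'⟩
  -- `w(E) = -1`
  have hw : W.rootNumber = -1 := by
    rw [WeierstrassCurve.rootNumber_eq_neg_one_pow_analyticRank_of_exists_isNewformOf hnf W, hr]
    norm_num
  -- the admissible auxiliary field (odd `d_K < -4`, Heegner for `N_E` and `p`, `L(E^{d_K},1) ≠ 0`)
  obtain ⟨K, _, _, hK, hodd, hlt, hHN, hHp, hLK⟩ :=
    exists_admissibleField_of_rootNumber_eq_neg_one hnf hHL W hw p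
  -- the datum with `p ∤ c`, a Heegner datum and the `K`-rational Heegner point
  obtain ⟨Dt, hcM⟩ := hMan
  obtain ⟨β, hβ⟩ := exists_dvd_sq_sub_discr_holds (W.conductorNorm ℤ) K hK hHN
  obtain ⟨H, -⟩ := nonempty_heegnerDatum_holds (W.conductorNorm ℤ) K hK hβ
  obtain ⟨ι⟩ : Nonempty (K →+* ℂ) := inferInstance
  obtain ⟨P, hP⟩ := hHP (W.conductorNorm ℤ) W K hK hHN Dt H ι
  -- the Heegner point has infinite order: `L'(E/K,1) = L'(E,1)·L(E^K,1) ≠ 0` (Gross–Zagier)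
  have hL0 : W.entireLFunction 1 = 0 := entireLFunction_one_eq_zero_of_analyticRank_eq_one hr
  obtain ⟨-, hderiv⟩ := leadingLCoeff_eq_deriv_of_analyticRank_eq_one hr
  have hLKd : LDerivEK W K ≠ 0 := by
    rw [lDerivEK_eq_deriv_mul W K hmod hL0]
    exact mul_ne_zero hderiv hLK
  have hPH : IsHeegnerPoint (W.conductorNorm ℤ) W K P := ⟨Dt, H, ι, hP⟩
  have hPinf : ¬ IsOfFinAddOrder P :=
    (lDerivEK_ne_zero_iff_not_isOfFinAddOrder W (W.conductorNorm ℤ) K (hGZ _ W K) hK hHN hPH).mp hLKd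
  -- a globally minimal model of the twist (Néron) and its transport values
  have hD0 : (NumberField.discr K : ℚ) ≠ 0 := by exact_mod_cast NumberField.discr_ne_zero K
  haveI hEt : (W.quadraticTwist (NumberField.discr K : ℚ)).IsElliptic :=
    W.isElliptic_quadraticTwist hD0
  obtain ⟨Cd, hCd⟩ := hasGlobalMinimalModel_rat_holds (W.quadraticTwist (NumberField.discr K : ℚ))
  set Wd : WeierstrassCurve ℚ := Cd • W.quadraticTwist (NumberField.discr K : ℚ) with hWd_def
  haveI : Wd.IsGloballyMinimal := hCd
  have hWd : Cd • W.quadraticTwist (NumberField.discr K : ℚ) = Wd := rfl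
  have hC : Cd⁻¹ • Wd = W.quadraticTwist (NumberField.discr K : ℚ) := by
    rw [← hWd, inv_smul_smul]
  obtain ⟨htam, hu⟩ := twistTransportPackage_holds W p K Wd Cd ⟨hr, hp2, hred, hmult⟩ hK hodd hHN hWd
  have htamK : padicValNat p (W.baseChange K).tamagawaProduct = 2 * padicValNat p W.tamagawaProduct :=
    padicValNat_tamagawaProduct_baseChange_of_heegner_odd W p hp2 K hK hodd hHN hHp
  -- the twist has analytic rank `0`; its rank-zero `p`-part from the supply
  have hLd : Wd.entireLFunction 1 ≠ 0 := by
    rw [← hWd, entireLFunction_smul]; exact hLK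
  have hrd : Wd.analyticRank = 0 := (Wd.analyticRank_eq_zero_iff_holds (hmod _)).2 hLd
  have htw : PPartRankZero Wd p := hpartner K hK hodd hlt hHN hHp hLK Wd ⟨Cd⁻¹, hC⟩ hrd
  -- the anticyclotomic `ℤ_p`-extension, a topological generator, a degree-one prime above `p`
  haveI : IsTotallyComplex K := hK.2
  obtain ⟨κ, hκ⟩ := ZpExtension.exists_isAnticyclotomic_holds (K := K) (p := p) hK.1
    (fun w ↦ IsTotallyComplex.isComplex w)
  obtain ⟨γ, hγ⟩ := κ.surjective (Multiplicative.ofAdd 1)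
  haveI : Fact (κ.IsTopGenerator γ) := ⟨hγ⟩
  obtain ⟨𝔭, h𝔭, he, hf⟩ := X11b.exists_degreeOnePrime_of_splitsIn K p hK.1 (hHp p hp dvd_rfl)
  -- conclude by §1
  exact bsdp_of_cellC_of_not_split_of_hsieh2014_of_intHalvesOther_of_partner W p hnf hPT hPT2 hEP hcd
    hBr hH (W.conductorNorm ℤ) K Dt H ι P (hGZ _ W K) (hKo _ W K) hGZK ⟨hr, hp2, hred, hmult⟩ hns rfl
    hK hlt hodd hHN hHp hP hPinf hcM hLK Wd Cd hWd htw htam hu htamK κ hκ γ 𝔭 h𝔭 he hf h2 h3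

/-- **X2c ∩ {non-split}, pointwise with a Manin datum, parity-cases form, IMC atom RE-ORIENTED** —
`X2.bsdp_of_cellC_of_not_split_of_manin_of_intResiduals` with `h3 : X2.NonsplitIMCEqOnTreeIntOther W p`:
the partner's rank-zero `p`-part by cases on its Greenberg–Vatsal parity (X2a CLOSED,
`targetA_of_published`; X2b ∩ {non-split} = the input `hMCB` through
`bsdp_of_mazurMainConjectureAt_of_analyticRank_eq_zero`). CONDITIONAL on every listed binder; nothing
booked. [cite: CastellaEtAl2021, Thm. 5.3.1 and (5.5)–(5.7)] [cite: GreenbergVatsal2000, Thm. (1.3)]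
[claim: KellerYin2024, status: under-review] [cite: Miller2011LMS, Def. 1.1] -/
theorem bsdp_of_cellC_of_not_split_of_manin_of_intResidualsOther
    (hGV : lambdaMu_multiplicative_of_gvPar) (hWu : thm16_charIdeal_dvd_multiplicative_of_reducible)
    (hJs : thm61_splitMultiplicative) (hJn : thm61_nonsplitMultiplicative)
    (hHs : exists_isSplitMultCanonical) (hHn : exists_isMultCanonical)
    (hpar : nonempty_modularParametrizationData)
    (hGS : ∀ (W : WeierstrassCurve ℚ) [W.IsElliptic] [W.IsGloballyMinimal] (p : ℕ) [Fact p.Prime],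
      greenberg_stevens (W := W) (p := p))
    (hnf : exists_isNewformOf)
    (hPT : ∀ (K : Type) [Field K] [NumberField K], poitouTate_selmerStructure_duality K)
    (hPT2 : ∀ (K : Type) [Field K] [NumberField K], poitouTate_sha_tateDual K)
    (hEP : ∀ (K : Type) [Field K] [NumberField K] (v : HeightOneSpectrum (𝓞 K)),
      localEulerPoincareCharacteristic (v.adicCompletion K))
    (hcd : fieldCdLE_two_of_numberField)
    (hBr : ∀ (K : Type) [Field K] [NumberField K] (p : ℕ) [Fact p.Prime],
      ZpExtension.decomp_not_le_kerSubgroup_of_isAnticyclotomic K p)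
    (hH : hsieh2014_exists_anticyclotomicPAdicLFunction)
    (hGZ : ∀ (N : ℕ) [NeZero N] (W : WeierstrassCurve ℚ) (K : Type) [Field K] [NumberField K],
      gross_zagier N W K)
    (hKo : ∀ (N : ℕ) [NeZero N] (W : WeierstrassCurve ℚ) (K : Type) [Field K] [NumberField K],
      kolyvagin N W K)
    (hHP : ∀ (N : ℕ) [NeZero N] (W : WeierstrassCurve ℚ) (K : Type) [Field K] [NumberField K],
      heegnerPointComplex_mem_range_map N W K)
    (hGZK : rank_eq_analyticRank_of_analyticRank_le_one)
    (hHL : HoffsteinLuo1997_exists_twist_L_one_ne_zero)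
    (hc : CellC W p) (hns : ¬ W.HasSplitMultiplicativeReductionAtPrime p)
    (hMan : HasPrimeToManinDatum W p)
    (h2 : NonsplitBDPValueOnTreeInt W p) (h3 : NonsplitIMCEqOnTreeIntOther W p)
    (hMCB : ∀ (W' : WeierstrassCurve ℚ) [W'.IsElliptic] [W'.IsGloballyMinimal],
      CellB W' p → ¬ W'.HasSplitMultiplicativeReductionAtPrime p → MazurMainConjectureAt W' p) :
    BSDp W p := by
  have hmod : hasEntireLFunction_rat := WeierstrassCurve.hasEntireLFunction_rat_of_exists_isNewformOf hnf
  refine bsdp_of_cellC_of_not_split_of_manin_of_intResidualsOther_of_partner W p hnf hPT hPT2 hEP hcd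
    hBr hH hGZ hKo hHP hGZK hHL hc hns hMan h2 h3 ?_
  intro K _ _ hK _ _ _ hHp _ Wd _ _ hWd hrd
  obtain ⟨C, hC⟩ := hWd
  have hXd : ClassX2 Wd p := classX2_twist W p hc.2 K hK hHp Wd ⟨C, hC⟩
  have hnsd : ¬ Wd.HasSplitMultiplicativeReductionAtPrime p :=
    not_hasSplitMultiplicativeReductionAtPrime_of_smul_eq_quadraticTwist W Wd hK p hc.2.1 hc.2.2.2
      hns hHp hC
  have hbsdd : BSDp Wd p := by
    by_cases hgv : GVPar Wd p
    · exact targetA_of_published hGV hWu hJs hJn hHs hHn hGZK hmod hpar hGS Wd p ⟨hrd, hXd, hgv⟩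
    · exact bsdp_of_mazurMainConjectureAt_of_analyticRank_eq_zero hJs hJn hHs hHn hGZK hmod hpar Wd p
        (hGS Wd p) hXd.1 hXd.2.2 hrd (hMCB Wd ⟨hrd, hXd, hgv⟩ hnsd)
  exact pPartRankZero_of_pPart hGZK Wd p hrd (pPart_of_bsdp hmod hGZK Wd p (by omega) hbsdd)

/-- **X2c ∩ {SPLIT}, pointwise with a Manin datum, parity-cases form, IMC atom RE-ORIENTED and
CTL-split a THEOREM** — `X2.bsdp_of_cellC_of_split_of_manin_of_intResiduals` with
`h3 : X2.SplitIMCEqOnTreeIntOther W p` and the hypothesis `hCTL : SplitControlOnTree W p` DISCHARGED by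
`Theorems.CtlLoc.splitControlOnTree_of_cellC` (k5-c4 g5, p484252: class-wide, any torsion, from the cited
facts `hGZK hnf hPT hPT2 hEP hBr`). The datum is produced verbatim as there; then §1.
CONDITIONAL on every listed binder; nothing booked. [cite: CastellaEtAl2021, Thm. 5.3.1 and (5.5)–(5.7)]
[cite: Hsieh2014, Thm. 1 (arXiv:1112.1580 pp. 3–4)] [claim: KellerYin2024, status: under-review]
[cite: Castella2018, Thm. 2.3 (arXiv:1704.06608 p. 5)] [cite: Miller2011LMS, Def. 1.1] -/
theorem bsdp_of_cellC_of_split_of_manin_of_intResidualsOther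
    (hGV : lambdaMu_multiplicative_of_gvPar) (hWu : thm16_charIdeal_dvd_multiplicative_of_reducible)
    (hJs : thm61_splitMultiplicative) (hJn : thm61_nonsplitMultiplicative)
    (hHs : exists_isSplitMultCanonical) (hHn : exists_isMultCanonical)
    (hpar : nonempty_modularParametrizationData)
    (hGS : ∀ (W : WeierstrassCurve ℚ) [W.IsElliptic] [W.IsGloballyMinimal] (p : ℕ) [Fact p.Prime],
      greenberg_stevens (W := W) (p := p))
    (hnf : exists_isNewformOf)
    (hPT : ∀ (K : Type) [Field K] [NumberField K], poitouTate_selmerStructure_duality K)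
    (hPT2 : ∀ (K : Type) [Field K] [NumberField K], poitouTate_sha_tateDual K)
    (hEP : ∀ (K : Type) [Field K] [NumberField K] (v : HeightOneSpectrum (𝓞 K)),
      localEulerPoincareCharacteristic (v.adicCompletion K))
    (hBr : ∀ (K : Type) [Field K] [NumberField K] (p : ℕ) [Fact p.Prime],
      ZpExtension.decomp_not_le_kerSubgroup_of_isAnticyclotomic K p)
    (hH : hsieh2014_exists_anticyclotomicPAdicLFunction)
    (hGZ : ∀ (N : ℕ) [NeZero N] (W : WeierstrassCurve ℚ) (K : Type) [Field K] [NumberField K],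
      gross_zagier N W K)
    (hKo : ∀ (N : ℕ) [NeZero N] (W : WeierstrassCurve ℚ) (K : Type) [Field K] [NumberField K],
      kolyvagin N W K)
    (hHP : ∀ (N : ℕ) [NeZero N] (W : WeierstrassCurve ℚ) (K : Type) [Field K] [NumberField K],
      heegnerPointComplex_mem_range_map N W K)
    (hGZK : rank_eq_analyticRank_of_analyticRank_le_one)
    (hHL : HoffsteinLuo1997_exists_twist_L_one_ne_zero)
    (hc : CellC W p) (hs : W.HasSplitMultiplicativeReductionAtPrime p)
    (hMan : HasPrimeToManinDatum W p)
    (h2 : SplitBDPValueOnTreeInt W p) (h3 : SplitIMCEqOnTreeIntOther W p)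
    (hMCB : ∀ (W' : WeierstrassCurve ℚ) [W'.IsElliptic] [W'.IsGloballyMinimal],
      CellB W' p → W'.HasSplitMultiplicativeReductionAtPrime p → MazurMainConjectureAt W' p) :
    BSDp W p := by
  have hp : p.Prime := Fact.out
  have hmod : hasEntireLFunction_rat := WeierstrassCurve.hasEntireLFunction_rat_of_exists_isNewformOf hnf
  have hCTL : SplitControlOnTree W p :=
    CtlLoc.splitControlOnTree_of_cellC W p hGZK hnf hPT hPT2 hEP hBr hc hs
  obtain ⟨hr, hp2, hred, hmult⟩ := hc
  haveI : NeZero (W.conductorNorm ℤ) := ⟨(W.conductorNorm_pos_holds).ne'⟩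
  -- `w(E) = -1`
  have hw : W.rootNumber = -1 := by
    rw [WeierstrassCurve.rootNumber_eq_neg_one_pow_analyticRank_of_exists_isNewformOf hnf W, hr]
    norm_num
  -- the admissible auxiliary field
  obtain ⟨K, _, _, hK, hodd, hlt, hHN, hHp, hLK⟩ :=
    exists_admissibleField_of_rootNumber_eq_neg_one hnf hHL W hw p
  -- the datum with `p ∤ c`, a Heegner datum and the `K`-rational Heegner point
  obtain ⟨Dt, hcM⟩ := hMan
  obtain ⟨β, hβ⟩ := exists_dvd_sq_sub_discr_holds (W.conductorNorm ℤ) K hK hHN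
  obtain ⟨H, -⟩ := nonempty_heegnerDatum_holds (W.conductorNorm ℤ) K hK hβ
  obtain ⟨ι⟩ : Nonempty (K →+* ℂ) := inferInstance
  obtain ⟨P, hP⟩ := hHP (W.conductorNorm ℤ) W K hK hHN Dt H ι
  -- the Heegner point has infinite order (Gross–Zagier)
  have hL0 : W.entireLFunction 1 = 0 := entireLFunction_one_eq_zero_of_analyticRank_eq_one hr
  obtain ⟨-, hderiv⟩ := leadingLCoeff_eq_deriv_of_analyticRank_eq_one hr
  have hLKd : LDerivEK W K ≠ 0 := by
    rw [lDerivEK_eq_deriv_mul W K hmod hL0]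
    exact mul_ne_zero hderiv hLK
  have hPH : IsHeegnerPoint (W.conductorNorm ℤ) W K P := ⟨Dt, H, ι, hP⟩
  have hPinf : ¬ IsOfFinAddOrder P :=
    (lDerivEK_ne_zero_iff_not_isOfFinAddOrder W (W.conductorNorm ℤ) K (hGZ _ W K) hK hHN hPH).mp hLKd
  -- a globally minimal model of the twist (Néron) and its transport values
  have hD0 : (NumberField.discr K : ℚ) ≠ 0 := by exact_mod_cast NumberField.discr_ne_zero K
  haveI hEt : (W.quadraticTwist (NumberField.discr K : ℚ)).IsElliptic :=
    W.isElliptic_quadraticTwist hD0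
  obtain ⟨Cd, hCd⟩ := hasGlobalMinimalModel_rat_holds (W.quadraticTwist (NumberField.discr K : ℚ))
  set Wd : WeierstrassCurve ℚ := Cd • W.quadraticTwist (NumberField.discr K : ℚ) with hWd_def
  haveI : Wd.IsGloballyMinimal := hCd
  have hWd : Cd • W.quadraticTwist (NumberField.discr K : ℚ) = Wd := rfl
  have hC : Cd⁻¹ • Wd = W.quadraticTwist (NumberField.discr K : ℚ) := by
    rw [← hWd, inv_smul_smul]
  obtain ⟨htam, hu⟩ := twistTransportPackage_holds W p K Wd Cd ⟨hr, hp2, hred, hmult⟩ hK hodd hHN hWd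
  have htamK : padicValNat p (W.baseChange K).tamagawaProduct = 2 * padicValNat p W.tamagawaProduct :=
    padicValNat_tamagawaProduct_baseChange_of_heegner_odd W p hp2 K hK hodd hHN hHp
  -- the twist: analytic rank `0`, X2, SPLIT at `p`; its rank-zero `p`-part by parity cases
  have hLd : Wd.entireLFunction 1 ≠ 0 := by
    rw [← hWd, entireLFunction_smul]; exact hLK
  have hrd : Wd.analyticRank = 0 := (Wd.analyticRank_eq_zero_iff_holds (hmod _)).2 hLd
  have hXd : ClassX2 Wd p := classX2_twist W p ⟨hp2, hred, hmult⟩ K hK hHp Wd ⟨Cd⁻¹, hC⟩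
  have hsd : Wd.HasSplitMultiplicativeReductionAtPrime p :=
    (hasSplitMultiplicativeReductionAtPrime_iff_of_smul_eq_quadraticTwist W Wd hK p hp2 hmult hHp
      hC).mpr hs
  have hbsdd : BSDp Wd p := by
    by_cases hgv : GVPar Wd p
    · exact targetA_of_published hGV hWu hJs hJn hHs hHn hGZK hmod hpar hGS Wd p ⟨hrd, hXd, hgv⟩
    · exact bsdp_of_mazurMainConjectureAt_of_analyticRank_eq_zero hJs hJn hHs hHn hGZK hmod hpar Wd p
        (hGS Wd p) hXd.1 hXd.2.2 hrd (hMCB Wd ⟨hrd, hXd, hgv⟩ hsd)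
  have htw : PPartRankZero Wd p :=
    pPartRankZero_of_pPart hGZK Wd p hrd (pPart_of_bsdp hmod hGZK Wd p (by omega) hbsdd)
  -- the anticyclotomic `ℤ_p`-extension, a topological generator, a degree-one prime above `p`
  haveI : IsTotallyComplex K := hK.2
  obtain ⟨κ, hκ⟩ := ZpExtension.exists_isAnticyclotomic_holds (K := K) (p := p) hK.1
    (fun w ↦ IsTotallyComplex.isComplex w)
  obtain ⟨γ, hγ⟩ := κ.surjective (Multiplicative.ofAdd 1)
  haveI : Fact (κ.IsTopGenerator γ) := ⟨hγ⟩
  obtain ⟨𝔭, h𝔭, he, hf⟩ := X11b.exists_degreeOnePrime_of_splitsIn K p hK.1 (hHp p hp dvd_rfl)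
  -- conclude by §1
  exact bsdp_of_cellC_of_split_of_hsieh2014_of_intHalvesOther_of_partner W p hGZK hnf hH
    (W.conductorNorm ℤ) K Dt H ι P (hGZ _ W K) (hKo _ W K) ⟨hr, hp2, hred, hmult⟩ hs rfl hK hlt hodd
    hHN hHp hP hPinf hcM hLK Wd Cd hWd htw htam hu htamK κ hκ γ 𝔭 h𝔭 he hf h2 h3 hCTL

end Pointwise

end Summit.BirchSwinnertonDyer.BirchSwinnertonDyer.Theorems.Reoriented

end
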